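import Literature.AnabelianGeometry.SemiGraphs.TemperedEdgeLikeCentralizerOfSaturated
import Literature.AnabelianGeometry.SemiGraphs.TemperedGeodesicEdgesHostable
import HarnessLib

/-!
# [SemiAnbd] Thm 3.7 (iii): every edge of a fixed geodesic between two compatible fixed vertex systems
# is the edge of a compatible EDGE-POINT SEQUENCE all of whose edges are fixed (proof-only tool)

Mochizuki, *Semi-graphs of anabelioids*, Publ. RIMS **42** (2006), §3, Theorem 3.7 (iii), proof p. 41
(compatible systems of fixed vertices are compared level by level; author's *Comments* (2020) (6)(b))
[cite: MochizukiSemiAnbd2006, Thm 3.7(iii) p.41].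

PROOF-ONLY tool file (cell abc-iut, block F, FACT-LIST rows F-2772 `EdgeLikeCentralizerAt` / F-2773
`EdgeLikeCentralizer`; seat abc-iut-f-176 gen 5; no definition, no named fact).  abc-iut-f-176 gen 4's
`exists_edgeLike_ge_of_mem_geodesic` (TemperedGeodesicEdgesHostable.lean) shows that a base edge under a
fixed geodesic carries an edge-like subgroup containing `C`; here the same recursion (downwards by the
transition maps, upwards because the image of a higher geodesic covers the lower one —
`SemiGraph.exists_edge_geodesic_of_le`) is run in the language of the Galois tower `D` and its output is
kept: **the given tree edge `ε` of a geodesic of `𝔾̃_K` between two compatible `C`-fixed vertex systems is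
`T.edge K` for a compatible edge-point sequence `T` (`exists_edgeSeq_edge_eq`) ALL of whose edges
`T.edge n` are `C`-fixed** (`exists_fixing_edgeSeq_through_geodesic_edge`; branch form
`exists_fixing_edgeSeq_through_geodesic_branch`).  Consequence used by the sequel: the stabiliser of such
an `ε` in `Gal(𝒢_{∞,K}/𝒢)` is the image of the edge decomposition homomorphism of `T`
(`EdgeSeq.exists_galE_eq_proj_of_fixes`), i.e. every host met by a fixed geodesic is a LIMIT host — so
saturation hypotheses need only be imposed on compatible fixed edge systems (edge-like subgroups
containing `C`), an intrinsic condition.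

Nothing here bears on [IUTchIII] Cor. 3.12; typed ≠ proved elsewhere.
-/

namespace Literature.AnabelianGeometry.SemiGraphs

namespace ProfiniteSemiGraph

namespace GaloisLevelData

open CategoryTheory Topology

universe u

variable {𝒢 : ProfiniteSemiGraph.{u}} (D : GaloisLevelData 𝒢) (h𝒢 : 𝒢.IsCountable)

/-- Transition maps compose on edges, pointwise. [cite: MochizukiSemiAnbd2006, Thm 3.7(iii) p.41] -/
theorem treeTrans_edgeMap_comp {i j k : ℕ} (hij : i ≤ j) (hjk : j ≤ k) (x : (D.tree k).Edge) :
    (D.treeTrans hij).edgeMap ((D.treeTrans hjk).edgeMap x) = (D.treeTrans (hij.trans hjk)).edgeMap x := by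
  have e := congrArg (fun φ => SemiGraph.Hom.edgeMap φ x) (D.treeTrans_comp hij hjk)
  simpa only [SemiGraph.comp_edgeMap, Function.comp_apply] using e

/-- `treeTrans (le_refl)` is the identity on edges. [cite: MochizukiSemiAnbd2006, Thm 3.7(iii) p.41] -/
theorem treeTrans_edgeMap_refl (j : ℕ) (x : (D.tree j).Edge) : (D.treeTrans (le_refl j)).edgeMap x = x := by
  rw [D.treeTrans_self]; rfl

/-- **A subgroup fixing the two ends of a path of `𝔾̃_n` fixes every edge on it** (paths of the subdivision
of a tree with fixed endpoints are fixed node by node). [cite: MochizukiSemiAnbd2006, Thm 3.7(iii) p.41] -/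
theorem edgeMap_eq_self_of_mem_path' (C : Subgroup (D.temperedPi h𝒢)) (n : ℕ) {a z : (D.tree n).Vertex}
    (ha : ∀ g ∈ C, (D.treeAct h𝒢 n g).hom.vertexMap a = a)
    (hz : ∀ g ∈ C, (D.treeAct h𝒢 n g).hom.vertexMap z = z)
    (p : (D.tree n).subdivision.Walk (Sum.inl a) (Sum.inl z)) (hp : p.IsPath) (ε : (D.tree n).Edge)
    (hε : (Sum.inr (Sum.inl ε) : (D.tree n).Node) ∈ p.support) :
    ∀ g ∈ C, (D.treeAct h𝒢 n g).hom.edgeMap ε = ε := by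
  intro g hg
  have h1 : SemiGraph.nodeMap (D.treeAct h𝒢 n g) (Sum.inl a) = Sum.inl a := by simp [ha g hg]
  have h2 : SemiGraph.nodeMap (D.treeAct h𝒢 n g) (Sum.inl z) = Sum.inl z := by simp [hz g hg]
  have h := SemiGraph.nodeMap_eq_self_of_isPath (D.isTree_tree n).isTree.isAcyclic _ h1 h2 p hp _ hε
  simpa only [SemiGraph.nodeMap_inr_inl, Sum.inr.injEq, Sum.inl.injEq] using h

/-- **Every edge of a fixed geodesic lies on a compatible edge-point sequence with fixed edges.**  For a
subgroup `C ≤ π₁^temp(𝒢)`, two compatible `C`-fixed vertex systems `x`, `x'` of the Galois tower `D` and an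
edge `ε` on the path `[x K, x' K]` of some level `K`: there are a base edge `e` and a compatible edge-point
sequence `T` over `e` with `T.edge K = ε` and every `T.edge n` fixed by `C` (below `K` the system is the image
of `ε`; above `K` it is chosen recursively on the geodesics, `SemiGraph.exists_edge_geodesic_of_le`).
[cite: MochizukiSemiAnbd2006, Thm 3.7(iii) p.41] -/
theorem exists_fixing_edgeSeq_through_geodesic_edge (C : Subgroup (D.temperedPi h𝒢))
    (x x' : ∀ n, (D.tree n).Vertex)
    (hx : ∀ ⦃i n : ℕ⦄ (hin : i ≤ n), (D.treeTrans hin).vertexMap (x n) = x i)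
    (hx' : ∀ ⦃i n : ℕ⦄ (hin : i ≤ n), (D.treeTrans hin).vertexMap (x' n) = x' i)
    (hfx : ∀ g ∈ C, ∀ n, (D.treeAct h𝒢 n g).hom.vertexMap (x n) = x n)
    (hfx' : ∀ g ∈ C, ∀ n, (D.treeAct h𝒢 n g).hom.vertexMap (x' n) = x' n)
    (K : ℕ) (p : (D.tree K).subdivision.Walk (Sum.inl (x K)) (Sum.inl (x' K))) (hp : p.IsPath)
    (ε : (D.tree K).Edge) (hε : (Sum.inr (Sum.inl ε) : (D.tree K).Node) ∈ p.support) :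
    ∃ (e : 𝒢.graph.Edge) (T : D.EdgeSeq h𝒢 e), T.edge K = ε ∧
      ∀ g ∈ C, ∀ n, (D.treeAct h𝒢 n g).hom.edgeMap (T.edge n) = T.edge n := by
  classical
  -- the geodesic at every level
  let q : ∀ j : ℕ, (D.tree j).subdivision.Path (Sum.inl (x j)) (Sum.inl (x' j)) := fun j =>
    ((D.isTree_tree j).isTree.connected (Sum.inl (x j)) (Sum.inl (x' j))).some.toPath
  -- `ε` lies on the geodesic of level `K`
  have hεq : (Sum.inr (Sum.inl ε) : (D.tree K).Node) ∈ (q K).1.support :=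
    SemiGraph.mem_support_of_mem_support_path (D.isTree_tree K).isTree.isAcyclic p hp hε (q K).1
  -- the compatible edge system: `treeTrans ε` below `K`, geodesic lifts above `K`
  let sys : ∀ j : ℕ, {e : (D.tree j).Edge // K ≤ j → (Sum.inr (Sum.inl e) : (D.tree j).Node) ∈ (q j).1.support} :=
    fun j => Nat.rec (motive := fun j =>
        {e : (D.tree j).Edge // K ≤ j → (Sum.inr (Sum.inl e) : (D.tree j).Node) ∈ (q j).1.support})
      ⟨(D.treeTrans (Nat.zero_le K)).edgeMap ε, fun h => by
        obtain rfl : K = 0 := Nat.le_zero.1 h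
        rwa [D.treeTrans_edgeMap_refl]⟩
      (fun j ih =>
        if h : j + 1 ≤ K then
          ⟨(D.treeTrans h).edgeMap ε, fun h' => by
            obtain rfl : K = j + 1 := le_antisymm h' h
            rwa [D.treeTrans_edgeMap_refl]⟩
        else
          ⟨Classical.choose (SemiGraph.exists_edge_geodesic_of_le D.tree (fun j => D.isTree_tree j)
              (fun _ _ h => D.treeTrans h) x x' hx hx' (Nat.le_succ j) (q j).1 (q j).2 (q (j + 1)).1
              (ih.2 (by omega))),
            fun _ => (Classical.choose_spec (SemiGraph.exists_edge_geodesic_of_le D.tree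
              (fun j => D.isTree_tree j) (fun _ _ h => D.treeTrans h) x x' hx hx' (Nat.le_succ j)
              (q j).1 (q j).2 (q (j + 1)).1 (ih.2 (by omega)))).1⟩) j
  -- below `K` the system is `treeTrans ε`
  have hlow : ∀ j (h : j ≤ K), (sys j).1 = (D.treeTrans h).edgeMap ε := by
    intro j h
    cases j with
    | zero => rfl
    | succ j =>
      show (dite (j + 1 ≤ K) _ _ : {e : (D.tree (j + 1)).Edge // _}).1 = _
      rw [dif_pos h]
  -- one-step compatibility
  have hstep : ∀ j, (D.treeTrans (Nat.le_succ j)).edgeMap (sys (j + 1)).1 = (sys j).1 := by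
    intro j
    by_cases h : j + 1 ≤ K
    · rw [hlow (j + 1) h, hlow j (by omega), D.treeTrans_edgeMap_comp]
    · show (D.treeTrans (Nat.le_succ j)).edgeMap (dite (j + 1 ≤ K) _ _ : {e : (D.tree (j + 1)).Edge // _}).1 = _
      rw [dif_neg h]
      exact (Classical.choose_spec (SemiGraph.exists_edge_geodesic_of_le D.tree (fun j => D.isTree_tree j)
        (fun _ _ h => D.treeTrans h) x x' hx hx' (Nat.le_succ j) (q j).1 (q j).2 (q (j + 1)).1
        ((sys j).2 (by omega)))).2
  -- compatibility
  have hcompat : ∀ ⦃i j : ℕ⦄ (h : i ≤ j), (D.treeTrans h).edgeMap (sys j).1 = (sys i).1 := by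
    intro i j h
    induction j, h using Nat.le_induction with
    | base => exact D.treeTrans_edgeMap_refl i _
    | succ j hij ih =>
      rw [← D.treeTrans_edgeMap_comp hij (Nat.le_succ j), hstep j, ih]
  -- every edge of the system is `C`-fixed
  have hfixK : ∀ g ∈ C, (D.treeAct h𝒢 K g).hom.edgeMap ε = ε :=
    D.edgeMap_eq_self_of_mem_path' h𝒢 C K (fun g hg => hfx g hg K) (fun g hg => hfx' g hg K) p hp ε hε
  have hfix : ∀ g ∈ C, ∀ j : ℕ, (D.treeAct h𝒢 j g).hom.edgeMap (sys j).1 = (sys j).1 := by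
    intro g hg j
    by_cases h : j ≤ K
    · have e1 := congrArg (fun φ => SemiGraph.Hom.edgeMap φ ε) (D.treeTrans_act h𝒢 h g)
      simp only [SemiGraph.comp_edgeMap, Function.comp_apply] at e1
      rw [hlow j h, ← e1, hfixK g hg]
    · exact D.edgeMap_eq_self_of_mem_path' h𝒢 C j (fun g hg => hfx g hg j) (fun g hg => hfx' g hg j) (q j).1
        (q j).2 _ ((sys j).2 (by omega)) g hg
  -- the edge-point sequence over the system
  obtain ⟨e, T, hT⟩ := D.exists_edgeSeq_edge_eq h𝒢 (fun j => (sys j).1) (fun i j h => hcompat h)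
  refine ⟨e, T, ?_, fun g hg n => ?_⟩
  · rw [hT K, hlow K le_rfl, D.treeTrans_edgeMap_refl]
  · rw [hT n]; exact hfix g hg n

/-- **Branch form**: the edge of a branch-point of the path `[x K, x' K]` lies on a compatible edge-point
sequence with `C`-fixed edges (on a path between vertex-points a branch-point is flanked by its
vertex-point and its edge-point, so the edge-point is on the path too).
[cite: MochizukiSemiAnbd2006, Thm 3.7(iii) p.41] -/
theorem exists_fixing_edgeSeq_through_geodesic_branch (C : Subgroup (D.temperedPi h𝒢))
    (x x' : ∀ n, (D.tree n).Vertex)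
    (hx : ∀ ⦃i n : ℕ⦄ (hin : i ≤ n), (D.treeTrans hin).vertexMap (x n) = x i)
    (hx' : ∀ ⦃i n : ℕ⦄ (hin : i ≤ n), (D.treeTrans hin).vertexMap (x' n) = x' i)
    (hfx : ∀ g ∈ C, ∀ n, (D.treeAct h𝒢 n g).hom.vertexMap (x n) = x n)
    (hfx' : ∀ g ∈ C, ∀ n, (D.treeAct h𝒢 n g).hom.vertexMap (x' n) = x' n)
    (K : ℕ) (p : (D.tree K).subdivision.Walk (Sum.inl (x K)) (Sum.inl (x' K))) (hp : p.IsPath)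
    (β : (D.tree K).Branch) (hβ : (Sum.inr (Sum.inr β) : (D.tree K).Node) ∈ p.support) :
    ∃ (e : 𝒢.graph.Edge) (T : D.EdgeSeq h𝒢 e), T.edge K = (D.tree K).edgeOf β ∧
      ∀ g ∈ C, ∀ n, (D.treeAct h𝒢 n g).hom.edgeMap (T.edge n) = T.edge n := by
  classical
  refine D.exists_fixing_edgeSeq_through_geodesic_edge h𝒢 C x x' hx hx' hfx hfx' K p hp _ ?_
  -- the edge-point of `β` is a neighbour of the branch-point `β` on the path
  obtain ⟨i, hi, hiβ⟩ : ∃ i, i ≤ p.length ∧ p.getVert i = Sum.inr (Sum.inr β) := by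
    obtain ⟨i, hi, h⟩ := SimpleGraph.Walk.mem_support_iff_exists_getVert.1 hβ
    exact ⟨i, h, hi⟩
  have hi0 : i ≠ 0 := by
    rintro rfl
    rw [SimpleGraph.Walk.getVert_zero] at hiβ
    simp at hiβ
  have hil : i ≠ p.length := by
    rintro rfl
    rw [SimpleGraph.Walk.getVert_length] at hiβ
    simp at hiβ
  obtain ⟨i₁, rfl⟩ := Nat.exists_eq_succ_of_ne_zero hi0
  have hprev : (D.tree K).subdivision.Adj (Sum.inr (Sum.inr β)) (p.getVert i₁) := by
    rw [← hiβ]; exact (p.adj_getVert_succ (by omega)).symm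
  have hnext : (D.tree K).subdivision.Adj (Sum.inr (Sum.inr β)) (p.getVert (i₁ + 2)) := by
    rw [← hiβ]; exact p.adj_getVert_succ (by omega)
  rcases ((D.tree K).subdivision_adj_branch_iff β _).1 hprev with h1 | ⟨v₁, hv₁, h1⟩
  · rw [← h1]; exact p.getVert_mem_support i₁
  rcases ((D.tree K).subdivision_adj_branch_iff β _).1 hnext with h2 | ⟨v₂, hv₂, h2⟩
  · rw [← h2]; exact p.getVert_mem_support (i₁ + 2)
  -- both neighbours are the vertex-point of `β`: contradicts injectivity of the path
  exfalso
  rw [hv₁] at hv₂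
  obtain rfl : v₁ = v₂ := by simpa using hv₂
  have heq : p.getVert i₁ = p.getVert (i₁ + 2) := by rw [h1, h2]
  have := hp.getVert_injOn (by rw [Set.mem_setOf_eq]; omega) (by rw [Set.mem_setOf_eq]; omega) heq
  omega

end GaloisLevelData

end ProfiniteSemiGraph

end Literature.AnabelianGeometry.SemiGraphs
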